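import Literature.NumberTheory.Transcendental.KZLogCalculusProofs
import Literature.NumberTheory.Transcendental.KZSemiCanonicalReductionProofs
import Literature.NumberTheory.Transcendental.SemialgebraicMapsProofs
import Literature.NumberTheory.Transcendental.EllIterRep

/-!
# `VolumeFormOffPlane` (stmt-KontsevichZagierPeriods-14935) — line `Sketch`,
stub `stub_logBoxCut` (log-box representations exist; cutting a log-box along a binomial wall)

For `a b : Fin n → ℝ` the LOG-BOX is
`B(a, b) = {p : ℝⁿ⁺¹ | a_j < x_j < b_j (j < n), 0 < z, z · ∏ x_j < 1}` with box coordinates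
`x_j = p (castSucc j)` and slack `z = p (last n)`.

* (i) For positive real-algebraic corners, `B(a, b)` is `ℚ`-semialgebraic (half-spaces with
  real-algebraic constants and two polynomial conditions) and bounded (it lies in the compact box
  `[a, b] × [0, (∏ a_j)⁻¹]`), hence carries an integrand-`1` representation (`KZ.exists_oneRep`).
* (ii) For `a_j ≤ c ≤ b_j`, the log-boxes over `(a, b[j ↦ c])` and `(a[j ↦ c], b)` are disjoint
  subsets of `B(a, b)` covering it up to the null wall `x_j = c`; so
  `[B(a,b)] − [B(a, b[j ↦ c])] − [B(a[j ↦ c], b)]` is a relation: one instance of rule (1a)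
  (split off the first piece exactly) followed by a null modification of the remainder
  (`KZ.of_sub_of_mem_relations_of_null`).

Sources: Kontsevich–Zagier 2001, §1.2, rule (1).
-/

noncomputable section

open MeasureTheory Set MvPolynomial
open Literature.NumberTheory.Transcendental Literature.ModelTheory.ExponentialFields

namespace Summit.KontsevichZagierPeriods.SymplecticScissors.LogPolytope

/-! ## The log-box: semialgebraicity and boundedness -/

/-- Log-boxes with real-algebraic corners are `ℚ`-semialgebraic. [folklore] -/
theorem lbc_isSemialgebraic_logBox {n : ℕ} {a b : Fin n → ℝ} (ha : ∀ j, IsAlgebraic ℚ (a j))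
    (hb : ∀ j, IsAlgebraic ℚ (b j)) :
    IsSemialgebraic ℚ {p : Fin (n + 1) → ℝ | (∀ j : Fin n, a j < p (Fin.castSucc j) ∧
      p (Fin.castSucc j) < b j) ∧ 0 < p (Fin.last n) ∧
      p (Fin.last n) * ∏ j : Fin n, p (Fin.castSucc j) < 1} := by
  have hbox : IsSemialgebraic ℚ (⋂ j ∈ (Finset.univ : Finset (Fin n)),
      ({p : Fin (n + 1) → ℝ | a j < p (Fin.castSucc j)} ∩ {p | p (Fin.castSucc j) < b j})) :=
    IsSemialgebraic.biInter _ _ fun j _ =>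
      (KZ.isSemialgebraic_setOf_const_lt_apply (ha j) _).inter
        (KZ.isSemialgebraic_setOf_apply_lt_const (hb j) _)
  have hz := isSemialgebraic_setOf_eval_pos (k := ℚ) (R := ℝ)
    (X (Fin.last n) : MvPolynomial (Fin (n + 1)) ℚ)
  have hprod := isSemialgebraic_setOf_eval_lt (k := ℚ) (R := ℝ)
    (X (Fin.last n) * ∏ j : Fin n, X (Fin.castSucc j) : MvPolynomial (Fin (n + 1)) ℚ) (C 1)
  convert (hbox.inter hz).inter hprod using 1
  ext p
  simp [map_prod, and_assoc]

/-- Log-boxes with positive lower corner lie in the compact box `[a, b] × [0, (∏ a_j)⁻¹]`.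
[folklore] -/
theorem lbc_logBox_subset_Icc {n : ℕ} {a b : Fin n → ℝ} (ha : ∀ j, 0 < a j) :
    {p : Fin (n + 1) → ℝ | (∀ j : Fin n, a j < p (Fin.castSucc j) ∧
      p (Fin.castSucc j) < b j) ∧ 0 < p (Fin.last n) ∧
      p (Fin.last n) * ∏ j : Fin n, p (Fin.castSucc j) < 1} ⊆
    Icc (Fin.snoc a 0 : Fin (n + 1) → ℝ) (Fin.snoc b (∏ j, a j)⁻¹) := by
  rintro p ⟨hbox, hz, hprod⟩
  have hpa : 0 < ∏ j, a j := Finset.prod_pos fun j _ => ha j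
  have hle : ∏ j, a j ≤ ∏ j, p (Fin.castSucc j) :=
    Finset.prod_le_prod (fun j _ => (ha j).le) fun j _ => (hbox j).1.le
  have hzle : p (Fin.last n) ≤ (∏ j, a j)⁻¹ := by
    rw [← one_div, le_div_iff₀ hpa]
    nlinarith [mul_le_mul_of_nonneg_left hle hz.le]
  constructor
  · intro i
    induction i using Fin.lastCases with
    | last => simpa using hz.le
    | cast j => simpa using (hbox j).1.le
  · intro i
    induction i using Fin.lastCases with
    | last => simpa using hzle
    | cast j => simpa using (hbox j).2.le

/-! ## Two disjoint pieces covering a domain up to a null set -/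

/-- If `r₁.domain`, `r₂.domain` are disjoint subsets of `r.domain` covering it up to a null set and
all three integrands are `1` on their domains, then `[r] − [r₁] − [r₂]` is a relation: rule (1a)
splits `r` exactly into `r₁` and the restriction of `r` to `r.domain ∖ r₁.domain`, which is a null
modification of `r₂`. [folklore] -/
theorem lbc_of_sub_sub_mem_relations {m : ℕ} {r r₁ r₂ : KZ.IntegralRep m}
    (h₁ : r₁.domain ⊆ r.domain) (h₂ : r₂.domain ⊆ r.domain) (hdisj : r₁.domain ∩ r₂.domain = ∅)
    (hcov : volume (r.domain \ (r₁.domain ∪ r₂.domain)) = 0)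
    (hr : ∀ p ∈ r.domain, r.integrand p = 1) (hr₁ : ∀ p ∈ r₁.domain, r₁.integrand p = 1)
    (hr₂ : ∀ p ∈ r₂.domain, r₂.integrand p = 1) :
    KZ.of r - KZ.of r₁ - KZ.of r₂ ∈ KZ.relations := by
  have hB : IsSemialgebraic ℚ (r.domain \ r₁.domain) :=
    r.isSemialgebraic_domain.diff r₁.isSemialgebraic_domain
  have hsplit : KZ.of r - KZ.of r₁ - KZ.of (r.restrict _ hB Set.sdiff_subset) ∈ KZ.relations :=
    KZ.domainAddRel_subset_relations ⟨m, r, r₁, r.restrict _ hB Set.sdiff_subset,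
      by rw [KZ.IntegralRep.domain_restrict, Set.union_sdiff_cancel h₁],
      by rw [KZ.IntegralRep.domain_restrict, Set.inter_sdiff_self, measure_empty],
      fun p hp => by rw [hr p (h₁ hp), hr₁ p hp], fun _ _ => rfl, rfl⟩
  have hnull : KZ.of (r.restrict _ hB Set.sdiff_subset) - KZ.of r₂ ∈ KZ.relations := by
    refine KZ.of_sub_of_mem_relations_of_null _ r₂ ?_ ?_ ?_
    · rw [KZ.IntegralRep.domain_restrict, Set.sdiff_sdiff]
      exact hcov
    · rw [KZ.IntegralRep.domain_restrict, Set.sdiff_sdiff_right, Set.sdiff_eq_empty.mpr h₂,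
        inter_comm, hdisj, empty_union, measure_empty]
    · rintro p ⟨⟨hp, -⟩, hp₂⟩
      rw [KZ.IntegralRep.integrand_restrict, hr p hp, hr₂ p hp₂]
  have : KZ.of r - KZ.of r₁ - KZ.of r₂ =
      (KZ.of r - KZ.of r₁ - KZ.of (r.restrict _ hB Set.sdiff_subset)) +
        (KZ.of (r.restrict _ hB Set.sdiff_subset) - KZ.of r₂) := by
    abel
  rw [this]
  exact KZ.relations.add_mem hsplit hnull

/-! ## The stub -/

/-- **Stub (log-box representations exist; cutting a log-box along a binomial wall).**
(i) For positive real-algebraic corners the log-box carries an integrand-`1` representation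
(it is `ℚ`-semialgebraic and bounded). (ii) For real-algebraic `c` with `a_j ≤ c ≤ b_j`, the log-box
over `(a, b)` is the union of the log-boxes over `(a, b[j ↦ c])` and `(a[j ↦ c], b)` up to the null
wall `x_j = c` (rule (1a) and a null modification). [folklore] -/
theorem stub_logBoxCut :
    (∀ (n : ℕ) (a b : Fin n → ℝ), (∀ j, 0 < a j) → (∀ j, IsAlgebraic ℚ (a j)) →
      (∀ j, IsAlgebraic ℚ (b j)) →
      ∃ r : KZ.IntegralRep (n + 1),
        r.domain = {p : Fin (n + 1) → ℝ | (∀ j : Fin n, a j < p (Fin.castSucc j) ∧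
          p (Fin.castSucc j) < b j) ∧ 0 < p (Fin.last n) ∧
          p (Fin.last n) * ∏ j : Fin n, p (Fin.castSucc j) < 1} ∧
        r.integrand = fun _ => 1) ∧
    (∀ (n : ℕ) (a b : Fin n → ℝ) (j : Fin n) (c : ℝ), IsAlgebraic ℚ c → a j ≤ c → c ≤ b j →
      ∀ (r r₁ r₂ : KZ.IntegralRep (n + 1)),
      r.domain = {p : Fin (n + 1) → ℝ | (∀ j : Fin n, a j < p (Fin.castSucc j) ∧
        p (Fin.castSucc j) < b j) ∧ 0 < p (Fin.last n) ∧
        p (Fin.last n) * ∏ j : Fin n, p (Fin.castSucc j) < 1} →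
      r₁.domain = {p : Fin (n + 1) → ℝ | (∀ i : Fin n, a i < p (Fin.castSucc i) ∧
        p (Fin.castSucc i) < Function.update b j c i) ∧ 0 < p (Fin.last n) ∧
        p (Fin.last n) * ∏ i : Fin n, p (Fin.castSucc i) < 1} →
      r₂.domain = {p : Fin (n + 1) → ℝ | (∀ i : Fin n, Function.update a j c i < p (Fin.castSucc i) ∧
        p (Fin.castSucc i) < b i) ∧ 0 < p (Fin.last n) ∧
        p (Fin.last n) * ∏ i : Fin n, p (Fin.castSucc i) < 1} →
      (∀ p ∈ r.domain, r.integrand p = 1) → (∀ p ∈ r₁.domain, r₁.integrand p = 1) →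
      (∀ p ∈ r₂.domain, r₂.integrand p = 1) →
      KZ.of r - KZ.of r₁ - KZ.of r₂ ∈ KZ.relations) := by
  refine ⟨fun n a b ha halg hbalg => ?_,
    fun n a b j c _ hac hcb r r₁ r₂ hr hr₁ hr₂ hri hr₁i hr₂i => ?_⟩
  · exact KZ.exists_oneRep (lbc_isSemialgebraic_logBox halg hbalg)
      (((measure_mono (lbc_logBox_subset_Icc (b := b) ha)).trans_lt
        isCompact_Icc.measure_lt_top).ne)
  · have hale : a ≤ Function.update a j c := le_update_self_iff.mpr hac
    have hble : Function.update b j c ≤ b := update_le_self_iff.mpr hcb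
    refine lbc_of_sub_sub_mem_relations ?_ ?_ ?_ ?_ hri hr₁i hr₂i
    · -- `B(a, b[j ↦ c]) ⊆ B(a, b)`
      rw [hr, hr₁]
      rintro p ⟨hbox, hz, hprod⟩
      exact ⟨fun i => ⟨(hbox i).1, (hbox i).2.trans_le (hble i)⟩, hz, hprod⟩
    · -- `B(a[j ↦ c], b) ⊆ B(a, b)`
      rw [hr, hr₂]
      rintro p ⟨hbox, hz, hprod⟩
      exact ⟨fun i => ⟨(hale i).trans_lt (hbox i).1, (hbox i).2⟩, hz, hprod⟩
    · -- the two pieces are disjoint (`x_j < c` versus `c < x_j`)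
      rw [hr₁, hr₂]
      refine eq_empty_of_forall_notMem fun p hp => ?_
      obtain ⟨⟨hbox₁, -, -⟩, ⟨hbox₂, -, -⟩⟩ := hp
      have h1 := (hbox₁ j).2
      have h2 := (hbox₂ j).1
      simp only [Function.update_self] at h1 h2
      exact lt_asymm h1 h2
    · -- the uncovered part lies in the null wall `x_j = c`
      rw [hr, hr₁, hr₂]
      refine measure_mono_null (fun p hp => ?_)
        (show volume {p : Fin (n + 1) → ℝ | p (Fin.castSucc j) = c} = 0 by
          rw [volume_pi]; exact Measure.pi_hyperplane _ _ _)
      obtain ⟨⟨hbox, hz, hprod⟩, hnot⟩ := hp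
      show p (Fin.castSucc j) = c
      rcases lt_trichotomy (p (Fin.castSucc j)) c with hlt | heq | hgt
      · refine (hnot (Or.inl ⟨fun i => ⟨(hbox i).1, ?_⟩, hz, hprod⟩)).elim
        rcases eq_or_ne i j with rfl | hij
        · simpa using hlt
        · rw [Function.update_of_ne hij]
          exact (hbox i).2
      · exact heq
      · refine (hnot (Or.inr ⟨fun i => ⟨?_, (hbox i).2⟩, hz, hprod⟩)).elim
        rcases eq_or_ne i j with rfl | hij
        · simpa using hgt
        · rw [Function.update_of_ne hij]
          exact (hbox i).1

end Summit.KontsevichZagierPeriods.SymplecticScissors.LogPolytope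

end
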